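import Summits.QuantumFields.YangMills.Theorems.BalabanUVNodesN07CritTangentConverse
import Literature.MathematicalPhysics.QuantumFieldTheory.Balaban1983to89.Node00.MultiScaleFibreChartLocal

/-!
# BalabanUVNodes ∕ N07 — PER-LEVEL LIFTS ⇒ THE RIGHT INVERSE (45) OF THE LINEARISED MULTI-SCALE CONSTRAINT (the `hH` socket of `Node00.MultiScaleFibreChart`):
# the ascending-level correction skeleton common to [Balaban1984PropagatorsII] p.228 («Q is onto», far-face lifts) and ROAD B (B4), typed once in the chart's velocity currency

Cell `pub-ymgap`, width seat `pub-ymgap-dag-n07-w2` generation 0 (HUMAN RULING D-0149; DAG node N07 = [15] = [Balaban1985Variational]; plan g77–g79 W-SEAT START LIST §n07 S2,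
successor piece S2b «supply (45) at U» — the road-agnostic SKELETON).  `--kind proof --supports stmt-QuantumFields-20542 --as helper` (K1⁷; count-neutral; theorems only).  CONSUMED BY NAME,
nothing modified: n07-e 35e `Thm.BalabanUVNodesN07CritTangentConverse.star_mul_deriv_mem_lieSU` (velocity of an `SU(N)` curve at `g` is `g·X`, `X ∈ 𝔰𝔲(N)`), this seat's
`Node00.MultiScaleFibreChart(Local)` (`suProj`, `suProj_coe`, `coe_suProj_of_mem`, `msChart`, `isFibreChartNear_msChart_of_smooth`, `hasDerivAt_wilsonAction4_expChart_of_isCritOnFibre_of_smooth_of_rightInverse`),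
`Node00.WilsonActionSecondVariation` (`star_coe_mul_coe_SU`, `coe_mul_star_coe_mul_SU`), 35a (`expChart`, `hasDerivAt_ray`, `expChart_zero`, `IsFibreChartNear`, `IsCritOnFibre`).

WHY.  The right-inverse hypothesis `hH` of the multi-scale chart ((45) at `U`: every multi-level family of tangent targets on the constrained bonds is the velocity family of one direction) is, on
both known roads, ASSEMBLED level by level: lit-balaban's `B6SectAOntoV1.exists_constr` ([Balaban1984PropagatorsII] p.228 «QGQ* is positive … an inverse is a well-defined operator», i.e. `Q`
onto — by far-face lifts: the level-`(n+1)` lift fixes level `n+1` exactly and does not disturb the levels `≤ n`) and n07-e's ROAD B (LOCATED-MULTISCALE-FIBRE § B: (B2) lower pins preserved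
EXACTLY, (B4) «levels corrected in ASCENDING order»).  The per-level LIFTS are where the roads differ (far-face crossing fields — route UnitScaleTilt `Prop7AvgLinearisation.exists_rightInverse_iterLin`
(flat, k-fold), `…Prop7CovRightInverse.exists_rightInverse_modelAvg` (covariant, small fields) — invisible below under [Balaban1984PropagatorsII] (2.3)'s indexing; ROAD B's interior controls under
reading (b); see `Node00/GenSetVsLamBond` and the cell's ME #35 answer of record); the INDUCTION is the same.  THIS FILE types the induction ONCE, abstractly (§1), and at NODE 00's objects in the
chart's velocity currency (§2: lifts ⇒ `hH`), and composes with the chart (§3: lifts ⇒ `IsFibreChartNear` ⇒ the tangent form on the joint kernel).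

CONTENTS.  §1 ★ `exists_preimage_of_levelCorrections` (additive `T : C →+ Π j, V j`; corrections exact at level `j`, zero at levels `< j`, `j ≤ k` ⇒ every target hit on all levels `≤ k`).
§2 `hasDerivAt_ray_of_differentiableAt`, `star_coe_mul_velocity_mem_lieSU`, ★★ `exists_velocity_preimage_of_levelLifts` (lifts ⇒ `hH`).  §3 ★★ `isFibreChartNear_msChart_of_levelLifts`,
★★★ `hasDerivAt_wilsonAction4_expChart_of_isCritOnFibre_of_levelLifts`.

HONEST FRAMING: [folklore] induction + bookkeeping in the tree's own objects; the LIFTS (`hlift`) and the local smoothness (`hsm`) are DISPLAYED HYPOTHESES, not constructed; nothing of [15]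
asserted; stub 1 ∕ K0⁷ NOT closed; N07 NOT discharged; counts unmoved (5∕27); one finite T⁴ programme at fixed ε — NOT continuum ∕ ℝ⁴ ∕ OS ∕ mass gap ∕ Clay (R4 closes the conditional rung
`BalabanLadder.UV` only).  No `sorry`, no definition, no `instance`, no `notation`.
-/

noncomputable section

open scoped Matrix.Norms.L2Operator Topology
open Filter

namespace Summit.QuantumFields.YangMills.BalabanUVNodes.N07MultiScaleLiftsRightInverse

open Literature.MathematicalPhysics.QuantumFieldTheory.Balaban1983to89
open Literature.MathematicalPhysics.QuantumFieldTheory.Balaban1983to89.T4Continuum (T4Family)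
open Literature.MathematicalPhysics.QuantumFieldTheory.Balaban1983to89.B15DeterminingSets
open Literature.MathematicalPhysics.QuantumFieldTheory.Balaban1983to89.T4AdjointCovarianceUnitary (lieSU)
open Literature.MathematicalPhysics.QuantumFieldTheory.Balaban1983to89.Node00
open Summit.QuantumFields.YangMills.BalabanUVNodes.N07CritTangentConverse (star_mul_deriv_mem_lieSU)

/-! ## §1  The ascending-level correction skeleton (abstract, additive) -/

/-- ★ **ASCENDING CORRECTION.**  Let `T : C →+ Π j, V j` be additive and suppose that for every level `j ≤ k` and every target `τ : V j` there is a correction `c` with `T c j = τ` and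
`T c i = 0` for all `i < j` (exact at its level, invisible below; its effect above `j` is irrelevant).  Then every family of targets is hit SIMULTANEOUSLY on all levels `≤ k`
(`c_{j+1} = c_j +` the correction of the level-`(j+1)` residual).  This is the induction of lit-balaban's `B6SectAOntoV1.exists_constr` (fine-to-coarse far-face lifts) and of n07-e's
ROAD B (B4) «levels corrected in ascending order», abstracted. [cite: Balaban1984PropagatorsII, p.228 («QGQ* is positive also and an inverse is a well-defined … operator»: Q onto)] -/
theorem exists_preimage_of_levelCorrections {C : Type*} [AddCommGroup C] {V : ℕ → Type*} [∀ j, AddCommGroup (V j)] (T : C →+ (∀ j, V j)) (k : ℕ)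
    (hcorr : ∀ j, j ≤ k → ∀ τ : V j, ∃ c : C, T c j = τ ∧ ∀ i, i < j → T c i = 0) (τ : ∀ j, V j) :
    ∃ c : C, ∀ j, j ≤ k → T c j = τ j := by
  induction k with
  | zero =>
    obtain ⟨c, hc, -⟩ := hcorr 0 le_rfl (τ 0)
    exact ⟨c, fun j hj => by obtain rfl := Nat.le_zero.1 hj; exact hc⟩
  | succ k ih =>
    obtain ⟨c, hc⟩ := ih fun j hj σ => hcorr j (hj.trans (Nat.le_succ k)) σ
    obtain ⟨d, hd, hd0⟩ := hcorr (k + 1) le_rfl (τ (k + 1) - T c (k + 1))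
    refine ⟨c + d, fun j hj => ?_⟩
    rcases Nat.lt_succ_iff_lt_or_eq.1 (Nat.lt_succ_of_le hj) with hlt | rfl
    · rw [map_add, Pi.add_apply, hc j (Nat.lt_succ_iff.1 hlt), hd0 j hlt, add_zero]
    · rw [map_add, Pi.add_apply, hd, add_sub_cancel]

/-! ## §2  At NODE 00's objects: per-level lifts in velocity currency ⇒ the right-inverse hypothesis `hH` of the multi-scale chart -/

section Velocity

variable {F : T4Family} {N : ℕ} [NeZero N]
variable {K k : ℕ} {𝔹 : DetSet (F.P K)} {W : MSField (F.P K) (SU N)} {U : GaugeField (F.P K) 0 (SU N)}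

/-- The velocity of a constrained output along the ray `t ↦ U·exp(tX)` is its Fréchet derivative at `0` applied to `X` (chain rule; the output `C¹` at `0`).
[cite: Balaban1985Variational, Sect. C (44) p.285 (the linearised averaging; bookkeeping)] -/
theorem hasDerivAt_ray_of_differentiableAt {j : ℕ} {c : PBond (F.P K) j}
    (hd : DifferentiableAt ℝ (fun X : PBond (F.P K) 0 → lieSU (Fin N) => ((avgFamily (avOfRecord F N K) (expChart U X) j c : SU N) : Matrix (Fin N) (Fin N) ℂ)) 0)
    (X : PBond (F.P K) 0 → lieSU (Fin N)) :
    HasDerivAt (fun t : ℝ => ((avgFamily (avOfRecord F N K) (expChart U (t • X)) j c : SU N) : Matrix (Fin N) (Fin N) ℂ))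
      (fderiv ℝ (fun X : PBond (F.P K) 0 → lieSU (Fin N) => ((avgFamily (avOfRecord F N K) (expChart U X) j c : SU N) : Matrix (Fin N) (Fin N) ℂ)) 0 X) 0 :=
  hd.hasFDerivAt.comp_hasDerivAt_of_eq (0 : ℝ) (hasDerivAt_ray X) (zero_smul ℝ X).symm

/-- On the fibre, `W_j(c)*` times the velocity of a constrained output lies in `𝔰𝔲(N)` (velocity of an `SU(N)`-valued curve through `W_j(c)`; 35e `star_mul_deriv_mem_lieSU`).
[cite: Balaban1985Variational, (4) p.278 (the group; bookkeeping)] -/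
theorem star_coe_mul_velocity_mem_lieSU (hU : AgreeOn 𝔹 (avgFamily (avOfRecord F N K) U) W) {j : ℕ} {c : PBond (F.P K) j} (hc : c ∈ bondsOf (𝔹 j))
    {X : PBond (F.P K) 0 → lieSU (Fin N)} {v : Matrix (Fin N) (Fin N) ℂ}
    (hv : HasDerivAt (fun t : ℝ => ((avgFamily (avOfRecord F N K) (expChart U (t • X)) j c : SU N) : Matrix (Fin N) (Fin N) ℂ)) v 0) :
    star ((W j c : SU N) : Matrix (Fin N) (Fin N) ℂ) * v ∈ lieSU (Fin N) := by
  have h := star_mul_deriv_mem_lieSU (γ := fun t : ℝ => avgFamily (avOfRecord F N K) (expChart U (t • X)) j c) hv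
  have h0 : avgFamily (avOfRecord F N K) (expChart U ((0 : ℝ) • X)) j c = W j c := by rw [zero_smul, expChart_zero]; exact hU j c hc
  rw [h0] at h
  exact h

/-- ★★ **PER-LEVEL LIFTS ⇒ THE RIGHT INVERSE (45) AT `U` IN VELOCITY CURRENCY** (the hypothesis `hH` of `Node00.MultiScaleFibreChart.isFibreChartNear_msChart`).  Hypotheses: `U` in the fibre
`𝔅(𝐁, W)`; every constrained output `X ↦ Ū^j(U·exp X)(c)`, `j ≤ k`, differentiable at `X = 0`; and for every level `j ≤ k` and every family `σ` of Lie-algebra targets on the constrained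
`j`-bonds a LIFT `X` whose velocities are `W_j(c)·σ(c)` at the constrained `j`-bonds and `0` at the constrained bonds of every level `i < j` (exact at its level, invisible below — far-face
lifts under [Balaban1984PropagatorsII] (2.3), or ROAD B's interior controls).  Then every multi-level target family `W_j(c)·τ_j(c)` on the constrained bonds of levels `≤ k` is the velocity
family of one direction `X`. [cite: Balaban1984PropagatorsII, p.228; Balaban1985Variational, (45) p.285 («L^jηQ_jHB = B on Λ_j, j = 0, 1, …, k»), (83) p.290] -/
theorem exists_velocity_preimage_of_levelLifts (hU : AgreeOn 𝔹 (avgFamily (avOfRecord F N K) U) W)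
    (hd : ∀ j, j ≤ k → ∀ c ∈ bondsOf (𝔹 j),
      DifferentiableAt ℝ (fun X : PBond (F.P K) 0 → lieSU (Fin N) => ((avgFamily (avOfRecord F N K) (expChart U X) j c : SU N) : Matrix (Fin N) (Fin N) ℂ)) 0)
    (hlift : ∀ j, j ≤ k → ∀ σ : PBond (F.P K) j → lieSU (Fin N), ∃ X : PBond (F.P K) 0 → lieSU (Fin N),
      (∀ c ∈ bondsOf (𝔹 j), HasDerivAt (fun t : ℝ => ((avgFamily (avOfRecord F N K) (expChart U (t • X)) j c : SU N) : Matrix (Fin N) (Fin N) ℂ))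
        (((W j c : SU N) : Matrix (Fin N) (Fin N) ℂ) * ((σ c : lieSU (Fin N)) : Matrix (Fin N) (Fin N) ℂ)) 0) ∧
      (∀ i, i < j → ∀ c ∈ bondsOf (𝔹 i), HasDerivAt (fun t : ℝ => ((avgFamily (avOfRecord F N K) (expChart U (t • X)) i c : SU N) : Matrix (Fin N) (Fin N) ℂ)) 0 0))
    (τ : (j : ℕ) → PBond (F.P K) j → lieSU (Fin N)) :
    ∃ X : PBond (F.P K) 0 → lieSU (Fin N), ∀ j, j ≤ k → ∀ c ∈ bondsOf (𝔹 j),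
      HasDerivAt (fun t : ℝ => ((avgFamily (avOfRecord F N K) (expChart U (t • X)) j c : SU N) : Matrix (Fin N) (Fin N) ℂ))
        (((W j c : SU N) : Matrix (Fin N) (Fin N) ℂ) * ((τ j c : lieSU (Fin N)) : Matrix (Fin N) (Fin N) ℂ)) 0 := by
  classical
  -- the Fréchet derivatives of the constrained outputs, and the Lie-algebra coordinate `π(W*·D_{j,c}X)`
  let D : (j : ℕ) → (c : PBond (F.P K) j) → (PBond (F.P K) 0 → lieSU (Fin N)) →L[ℝ] Matrix (Fin N) (Fin N) ℂ := fun j c =>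
    fderiv ℝ (fun X : PBond (F.P K) 0 → lieSU (Fin N) => ((avgFamily (avOfRecord F N K) (expChart U X) j c : SU N) : Matrix (Fin N) (Fin N) ℂ)) 0
  let V : ℕ → Type := fun j => {c : PBond (F.P K) j // c ∈ bondsOf (𝔹 j)} → lieSU (Fin N)
  let T : (PBond (F.P K) 0 → lieSU (Fin N)) →+ (∀ j, V j) :=
    { toFun := fun X j c => suProj N (star ((W j c.1 : SU N) : Matrix (Fin N) (Fin N) ℂ) * D j c.1 X)
      map_zero' := by
        funext j c
        show suProj N (star ((W j c.1 : SU N) : Matrix (Fin N) (Fin N) ℂ) * D j c.1 0) = (0 : lieSU (Fin N))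
        rw [map_zero, mul_zero, map_zero]
      map_add' := fun X Y => by
        funext j c
        show suProj N (star ((W j c.1 : SU N) : Matrix (Fin N) (Fin N) ℂ) * D j c.1 (X + Y)) =
          suProj N (star ((W j c.1 : SU N) : Matrix (Fin N) (Fin N) ℂ) * D j c.1 X) + suProj N (star ((W j c.1 : SU N) : Matrix (Fin N) (Fin N) ℂ) * D j c.1 Y)
        rw [map_add, mul_add, map_add] }
  have hT : ∀ (X : PBond (F.P K) 0 → lieSU (Fin N)) (j : ℕ) (c : {c : PBond (F.P K) j // c ∈ bondsOf (𝔹 j)}),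
      T X j c = suProj N (star ((W j c.1 : SU N) : Matrix (Fin N) (Fin N) ℂ) * D j c.1 X) := fun _ _ _ => rfl
  -- velocities along rays are the Fréchet derivatives
  have hvel : ∀ j, j ≤ k → ∀ c ∈ bondsOf (𝔹 j), ∀ (X : PBond (F.P K) 0 → lieSU (Fin N)) (v : Matrix (Fin N) (Fin N) ℂ),
      HasDerivAt (fun t : ℝ => ((avgFamily (avOfRecord F N K) (expChart U (t • X)) j c : SU N) : Matrix (Fin N) (Fin N) ℂ)) v 0 → D j c X = v :=
    fun j hj c hc X v hv => (hasDerivAt_ray_of_differentiableAt (hd j hj c hc) X).unique hv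
  -- per-level corrections for `T`
  have hcorr : ∀ j, j ≤ k → ∀ σ : V j, ∃ X, T X j = σ ∧ ∀ i, i < j → T X i = 0 := by
    intro j hj σ
    obtain ⟨X, hXj, hXlow⟩ := hlift j hj fun c => if hc : c ∈ bondsOf (𝔹 j) then σ ⟨c, hc⟩ else 0
    refine ⟨X, funext fun c => ?_, fun i hi => funext fun c => ?_⟩
    · have h := hvel j hj c.1 c.2 X _ (hXj c.1 c.2)
      rw [hT, h, dif_pos c.2, ← mul_assoc, star_coe_mul_coe_SU, one_mul, suProj_coe]
    · have h := hvel i (le_of_lt (lt_of_lt_of_le hi hj)) c.1 c.2 X _ (hXlow i hi c.1 c.2)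
      rw [hT, h, mul_zero, map_zero]
      rfl
  obtain ⟨X, hX⟩ := exists_preimage_of_levelCorrections T k hcorr fun j c => τ j c.1
  refine ⟨X, fun j hj c hc => ?_⟩
  have hcomp := congrFun (hX j hj) ⟨c, hc⟩
  rw [hT] at hcomp
  -- `π(W*·D X) = τ` with `W*·D X ∈ 𝔰𝔲(N)` ⇒ `D X = W·τ`
  have hmem : star ((W j c : SU N) : Matrix (Fin N) (Fin N) ℂ) * D j c X ∈ lieSU (Fin N) :=
    star_coe_mul_velocity_mem_lieSU hU hc (hasDerivAt_ray_of_differentiableAt (hd j hj c hc) X)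
  have hcoe : star ((W j c : SU N) : Matrix (Fin N) (Fin N) ℂ) * D j c X = ((τ j c : lieSU (Fin N)) : Matrix (Fin N) (Fin N) ℂ) := by
    rw [← coe_suProj_of_mem hmem, hcomp]
  have hDX : D j c X = ((W j c : SU N) : Matrix (Fin N) (Fin N) ℂ) * ((τ j c : lieSU (Fin N)) : Matrix (Fin N) (Fin N) ℂ) := by
    rw [← hcoe, coe_mul_star_coe_mul_SU]
  rw [← hDX]
  exact hasDerivAt_ray_of_differentiableAt (hd j hj c hc) X

end Velocity

/-! ## §3  From per-level lifts to the chart and to the tangent form (local-smoothness currency) -/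

section Tangent

variable {F : T4Family} {N : ℕ} [NeZero N]
variable {K k : ℕ} {𝔹 : DetSet (F.P K)} {W : MSField (F.P K) (SU N)} {U : GaugeField (F.P K) 0 (SU N)}

/-- ★★ **PER-LEVEL LIFTS ⇒ 35a's `IsFibreChartNear` FOR THE CANONICAL MULTI-SCALE CHART** (`Node00.MultiScaleFibreChartLocal.isFibreChartNear_msChart_of_smooth` with its `hH` supplied by §2).
[cite: Balaban1985Variational, (45)–(48) p.285, Prop. 3 p.289, (82)–(83) p.290; Balaban1984PropagatorsII, p.228] -/
theorem isFibreChartNear_msChart_of_levelLifts (h𝔹 : ∀ j, k < j → 𝔹 j = ∅) (hU : AgreeOn 𝔹 (avgFamily (avOfRecord F N K) U) W)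
    (hsm : ∀ j, j ≤ k → ∀ c ∈ bondsOf (𝔹 j), ContDiffAt ℝ 1 (fun X : PBond (F.P K) 0 → lieSU (Fin N) =>
      ((avgFamily (avOfRecord F N K) (expChart U X) j c : SU N) : Matrix (Fin N) (Fin N) ℂ)) 0)
    (hlift : ∀ j, j ≤ k → ∀ σ : PBond (F.P K) j → lieSU (Fin N), ∃ X : PBond (F.P K) 0 → lieSU (Fin N),
      (∀ c ∈ bondsOf (𝔹 j), HasDerivAt (fun t : ℝ => ((avgFamily (avOfRecord F N K) (expChart U (t • X)) j c : SU N) : Matrix (Fin N) (Fin N) ℂ))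
        (((W j c : SU N) : Matrix (Fin N) (Fin N) ℂ) * ((σ c : lieSU (Fin N)) : Matrix (Fin N) (Fin N) ℂ)) 0) ∧
      (∀ i, i < j → ∀ c ∈ bondsOf (𝔹 i), HasDerivAt (fun t : ℝ => ((avgFamily (avOfRecord F N K) (expChart U (t • X)) i c : SU N) : Matrix (Fin N) (Fin N) ℂ)) 0 0)) :
    IsFibreChartNear F N K 𝔹 W U (msChart F N K k 𝔹 W U) (fderiv ℝ (msChart F N K k 𝔹 W U) 0) :=
  isFibreChartNear_msChart_of_smooth h𝔹 hU hsm
    (exists_velocity_preimage_of_levelLifts hU (fun j hj c hc => (hsm j hj c hc).differentiableAt one_ne_zero) hlift)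

/-- ★★★ **CURVE-CRITICAL ⇒ TANGENT-CRITICAL ON A MULTI-SCALE FIBRE FROM PER-LEVEL LIFTS**: `𝐁` level-bounded, `U` in `𝔅(𝐁, W)`, constrained outputs `C¹` at `X = 0`, per-level lifts (exact at
their level, invisible at the constrained bonds below), `U` curve-critical for (5) on the fibre ⇒ `d∕dt A(U·exp(tX))∣₀ = 0` for every joint-kernel direction `X` — print's (82) on (83) for
[III] (2.10)–(2.12)'s fibres, the right inverse (45) being ASSEMBLED from the lifts by §1's ascending induction. [cite: Balaban1985Variational, (82)–(83) p.290, (141) p.299, Prop. 8 p.304, (45) p.285; Balaban1984PropagatorsII, p.228; Balaban1988Convergent, (2.10)–(2.12) p.256] -/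
theorem hasDerivAt_wilsonAction4_expChart_of_isCritOnFibre_of_levelLifts (h𝔹 : ∀ j, k < j → 𝔹 j = ∅)
    (hU : AgreeOn 𝔹 (avgFamily (avOfRecord F N K) U) W)
    (hsm : ∀ j, j ≤ k → ∀ c ∈ bondsOf (𝔹 j), ContDiffAt ℝ 1 (fun X : PBond (F.P K) 0 → lieSU (Fin N) =>
      ((avgFamily (avOfRecord F N K) (expChart U X) j c : SU N) : Matrix (Fin N) (Fin N) ℂ)) 0)
    (hlift : ∀ j, j ≤ k → ∀ σ : PBond (F.P K) j → lieSU (Fin N), ∃ X : PBond (F.P K) 0 → lieSU (Fin N),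
      (∀ c ∈ bondsOf (𝔹 j), HasDerivAt (fun t : ℝ => ((avgFamily (avOfRecord F N K) (expChart U (t • X)) j c : SU N) : Matrix (Fin N) (Fin N) ℂ))
        (((W j c : SU N) : Matrix (Fin N) (Fin N) ℂ) * ((σ c : lieSU (Fin N)) : Matrix (Fin N) (Fin N) ℂ)) 0) ∧
      (∀ i, i < j → ∀ c ∈ bondsOf (𝔹 i), HasDerivAt (fun t : ℝ => ((avgFamily (avOfRecord F N K) (expChart U (t • X)) i c : SU N) : Matrix (Fin N) (Fin N) ℂ)) 0 0))
    (hcrit : IsCritOnFibre F N K 𝔹 W U) {X : PBond (F.P K) 0 → lieSU (Fin N)}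
    (hX : ∀ j, j ≤ k → ∀ c ∈ bondsOf (𝔹 j),
      HasDerivAt (fun t : ℝ => ((avgFamily (avOfRecord F N K) (expChart U (t • X)) j c : SU N) : Matrix (Fin N) (Fin N) ℂ)) 0 0) :
    HasDerivAt (fun t : ℝ => wilsonAction4 (expChart U (t • X))) 0 0 :=
  hasDerivAt_wilsonAction4_expChart_of_isCritOnFibre_of_smooth_of_rightInverse h𝔹 hU hsm
    (exists_velocity_preimage_of_levelLifts hU (fun j hj c hc => (hsm j hj c hc).differentiableAt one_ne_zero) hlift) hcrit hX

end Tangent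

end Summit.QuantumFields.YangMills.BalabanUVNodes.N07MultiScaleLiftsRightInverse

end
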